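import Summits.Ventures.YMGap.FlowData.RectTubeFluxSectors
import Summits.Ventures.YMGap.FlowData.TubeVacuumSector
import HarnessLib

/-!
# Venture YMGap, track Y3 FLOW-DATA — rectangular cross-sections: the vacuum of the tube transfer operator carries
# no centre flux (`‖T ∘ P_0‖ = ‖T‖`, `E_0 = 0`; v2 twin of `TubeVacuumSector`)

HONEST FRAMING: venture file of the cell `pub-ymgap` (QuantumFields programme), track Y3; companion THEOREMS for
`FlowData/RectTubeTransferOperator.lean` (lead R237 (c) v2).  Same statements and proofs as
`FlowData/TubeVacuumSector.lean` on the rectangular torus: Jentzsch / Perron–Frobenius gives a unit a.e. positive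
ground state `φ₀`, unique up to scalars, which is twist-invariant for central `z` (`exists_rectVacuum`); hence
`P_0 φ₀ = φ₀`, `P_e φ₀ = 0` (`e ≠ 0`), **`rectTubeSectorNorm … 0 = ‖T‖`**, **`rectTubeFluxEnergy … 0 = 0`**.  Finite
spatial torus; no number, no row, nothing about limits or a mass gap.

References: M. Reed, B. Simon IV (1978) Thm. XIII.43–44 [cite: ReedSimonIV1978, §XIII.12]; G. 't Hooft, Nucl. Phys.
B 153 (1979) 141 [cite: tHooft1979Flux].
-/

noncomputable section

open scoped BigOperators ENNReal
open MeasureTheory Filter Function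
open Literature.MathematicalPhysics.QuantumFieldTheory Literature.Analysis.OperatorTheory
open Literature.MathematicalPhysics.QuantumLattice (RectTorusSite)

namespace Summit.Ventures.YMGap.FlowData

section RectNorm

variable {G : Type*} [Group G] [TopologicalSpace G] [IsTopologicalGroup G] [CompactSpace G]
  [MeasurableSpace G] [BorelSpace G] {k : ℕ} {Ls : Fin k → ℕ} [∀ i, NeZero (Ls i)]

/-- `‖C_s ψ‖ = ‖ψ‖` on the rectangular tube. [folklore] -/
@[simp] theorem norm_rectFluxTwistOp_apply (z : G) (s : Fin k → ZMod 2) (ψ : Lp ℝ 2 (rectSliceMeasure G Ls)) :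
    ‖rectFluxTwistOp Ls z s ψ‖ = ‖ψ‖ :=
  Lp.norm_compMeasurePreserving ψ (measurePreserving_rectFluxTwist z s)

end RectNorm

section Vacuum

variable {G : Type*} [Group G] [TopologicalSpace G] [IsTopologicalGroup G] [CompactSpace G]
  [MeasurableSpace G] [BorelSpace G] [SecondCountableTopology G] {n : ℕ} (ρ : G →* Matrix (Fin n) (Fin n) ℂ)
  (J : ℝ) {k : ℕ} {Ls : Fin k → ℕ} [∀ i, NeZero (Ls i)]

omit [SecondCountableTopology G] in
/-- A twist of an a.e. strictly positive function is a.e. strictly positive. [folklore] -/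
theorem isStrictlyPositiveFun_rectFluxTwistOp (z : G) (s : Fin k → ZMod 2) {φ : Lp ℝ 2 (rectSliceMeasure G Ls)}
    (hφ : IsStrictlyPositiveFun φ) : IsStrictlyPositiveFun (rectFluxTwistOp Ls z s φ) := by
  unfold IsStrictlyPositiveFun at hφ ⊢
  have h1 := (measurePreserving_rectFluxTwist z s).quasiMeasurePreserving.ae hφ
  filter_upwards [rectFluxTwistOp_ae_eq z s φ, h1] with a ha hpos
  rw [ha, Function.comp_apply]
  exact hpos

/-- **The vacuum is twist invariant.**  For central `z`: there is a unit, a.e. strictly positive `φ₀` with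
`T φ₀ = ‖T‖ φ₀`, every top eigenvector is a multiple of it, and `C_s φ₀ = φ₀` for every twist `s`
(Jentzsch simplicity: `C_s φ₀` is again a positive unit top eigenvector). [cite: ReedSimonIV1978, §XIII.12] -/
theorem exists_rectVacuum (hρ : Continuous ρ) (hρu : ∀ g, ρ g ∈ Matrix.unitaryGroup (Fin n) ℂ) {z : G}
    (hz : z ∈ Subgroup.center G) :
    ∃ φ₀ : Lp ℝ 2 (rectSliceMeasure G Ls), ‖φ₀‖ = 1 ∧ IsStrictlyPositiveFun φ₀ ∧
      rectTubeTransferOperator ρ J Ls φ₀ = ‖rectTubeTransferOperator ρ J Ls‖ • φ₀ ∧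
      (∀ η, rectTubeTransferOperator ρ J Ls η = ‖rectTubeTransferOperator ρ J Ls‖ • η → η = (@inner ℝ _ _ φ₀ η) • φ₀) ∧
      ∀ s : Fin k → ZMod 2, rectFluxTwistOp Ls z s φ₀ = φ₀ := by
  set T := rectTubeTransferOperator ρ J Ls with hT
  obtain ⟨φ₀, h1, hpos, heig, hsimple, -⟩ :=
    (isPositivityImproving_rectTubeTransferOperator J Ls hρ).exists_spectralGap
      (isSelfAdjoint_rectTubeTransferOperator J Ls hρ hρu) (isCompactOperator_rectTubeTransferOperator J Ls hρ)
      (norm_pos_iff.1 (norm_rectTubeTransferOperator_pos J Ls hρ))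
  refine ⟨φ₀, h1, hpos, heig, hsimple, fun s => ?_⟩
  -- `C_s φ₀` is a top eigenvector, hence `c • φ₀`
  have hcomm : T (rectFluxTwistOp Ls z s φ₀) = rectFluxTwistOp Ls z s (T φ₀) := by
    have h := congrArg (fun A => A φ₀) (rectFluxTwistOp_comp_rectTubeTransferOperator ρ J hρ hz s (Ls := Ls))
    simpa only [ContinuousLinearMap.comp_apply] using h.symm
  have heig' : T (rectFluxTwistOp Ls z s φ₀) = ‖T‖ • rectFluxTwistOp Ls z s φ₀ := by
    rw [hcomm, heig, map_smul]
  set c : ℝ := @inner ℝ _ _ φ₀ (rectFluxTwistOp Ls z s φ₀) with hc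
  have hcφ : rectFluxTwistOp Ls z s φ₀ = c • φ₀ := hsimple _ heig'
  -- `|c| = 1` (isometry) and `c > 0` (positivity), so `c = 1`
  have habs : |c| = 1 := by
    have h := norm_rectFluxTwistOp_apply z s φ₀
    rw [hcφ, norm_smul, Real.norm_eq_abs, h1, mul_one] at h
    exact h
  have hcpos : 0 < c := by
    have hsp := isStrictlyPositiveFun_rectFluxTwistOp z s hpos
    unfold IsStrictlyPositiveFun at hsp hpos
    rw [hcφ] at hsp
    have hae : ∀ᵐ a ∂(rectSliceMeasure G Ls), 0 < c := by
      filter_upwards [hsp, hpos, Lp.coeFn_smul c φ₀] with a ha hφa hsm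
      rw [hsm, Pi.smul_apply, smul_eq_mul] at ha
      exact pos_of_mul_pos_left ha hφa.le
    haveI : (ae (rectSliceMeasure G Ls)).NeBot := ae_neBot.2 (IsProbabilityMeasure.ne_zero _)
    exact hae.exists.choose_spec
  have hc1 : c = 1 := by
    rw [abs_of_pos hcpos] at habs
    exact habs
  rw [hcφ, hc1, one_smul]

omit [SecondCountableTopology G] in
/-- **The trivial-flux projection fixes the vacuum** and **every other sector projection kills it**:
`P_e φ = 2^{−k} (Σ_s χ_e(s)) φ` for a twist-invariant `φ`. [cite: tHooft1979Flux] -/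
theorem rectTubeFluxProjection_apply_of_invariant (z : G) {φ : Lp ℝ 2 (rectSliceMeasure G Ls)}
    (hφ : ∀ s : Fin k → ZMod 2, rectFluxTwistOp Ls z s φ = φ) (e : Fin k → ZMod 2) :
    rectTubeFluxProjection z Ls e φ = if e = 0 then φ else 0 := by
  unfold rectTubeFluxProjection fluxProjection
  rw [_root_.smul_apply, _root_.sum_apply]
  simp_rw [_root_.smul_apply, hφ, ← Finset.sum_smul, sum_fluxSign_right, ite_smul, zero_smul,
    smul_ite, smul_zero, smul_smul]
  have h2k : (2 : ℝ) ^ k ≠ 0 := by positivity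
  rw [inv_mul_cancel₀ h2k, one_smul]

/-- **The vacuum sector carries the norm: `‖T ∘ P_0‖ = ‖T‖`** (central `z`). [cite: tHooft1979Flux] -/
theorem rectTubeSectorNorm_zero (hρ : Continuous ρ) (hρu : ∀ g, ρ g ∈ Matrix.unitaryGroup (Fin n) ℂ) {z : G}
    (hz : z ∈ Subgroup.center G) :
    rectTubeSectorNorm ρ z J Ls 0 = ‖rectTubeTransferOperator ρ J Ls‖ := by
  refine le_antisymm (rectTubeSectorNorm_le_norm ρ z J Ls 0) ?_
  obtain ⟨φ₀, h1, -, heig, -, hinv⟩ := exists_rectVacuum ρ J hρ hρu hz (Ls := Ls)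
  have hP : rectTubeFluxProjection z Ls 0 φ₀ = φ₀ := by
    rw [rectTubeFluxProjection_apply_of_invariant z hinv, if_pos rfl]
  unfold rectTubeSectorNorm sectorNorm
  have h := ((rectTubeTransferOperator ρ J Ls).comp (rectTubeFluxProjection z Ls 0)).le_opNorm φ₀
  rw [ContinuousLinearMap.comp_apply] at h
  change ‖rectTubeTransferOperator ρ J Ls (rectTubeFluxProjection z Ls 0 φ₀)‖ ≤ _ at h
  rw [hP, heig, norm_smul, Real.norm_eq_abs, abs_of_nonneg (norm_nonneg _), h1, mul_one, mul_one] at h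
  exact h

/-- **The vacuum sector has flux energy zero: `E_0 = 0`** (central `z`). [folklore] -/
theorem rectTubeFluxEnergy_zero (hρ : Continuous ρ) (hρu : ∀ g, ρ g ∈ Matrix.unitaryGroup (Fin n) ℂ) {z : G}
    (hz : z ∈ Subgroup.center G) : rectTubeFluxEnergy ρ z J Ls 0 = 0 := by
  unfold rectTubeFluxEnergy fluxEnergy
  rw [show sectorNorm (rectTubeTransferOperator ρ J Ls) (rectFluxTwistOp Ls z) 0 = rectTubeSectorNorm ρ z J Ls 0 from rfl,
    rectTubeSectorNorm_zero ρ J hρ hρu hz, sub_self]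

/-- **The vacuum has no component in any non-trivial flux sector**: `P_e φ₀ = 0` for `e ≠ 0`. [cite: tHooft1979Flux] -/
theorem rectTubeFluxProjection_vacuum_eq_zero (hρ : Continuous ρ) (hρu : ∀ g, ρ g ∈ Matrix.unitaryGroup (Fin n) ℂ)
    {z : G} (hz : z ∈ Subgroup.center G) {e : Fin k → ZMod 2} (he : e ≠ 0) :
    ∃ φ₀ : Lp ℝ 2 (rectSliceMeasure G Ls), ‖φ₀‖ = 1 ∧ IsStrictlyPositiveFun φ₀ ∧
      rectTubeTransferOperator ρ J Ls φ₀ = ‖rectTubeTransferOperator ρ J Ls‖ • φ₀ ∧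
      rectTubeFluxProjection z Ls 0 φ₀ = φ₀ ∧ rectTubeFluxProjection z Ls e φ₀ = 0 := by
  obtain ⟨φ₀, h1, hpos, heig, -, hinv⟩ := exists_rectVacuum ρ J hρ hρu hz (Ls := Ls)
  refine ⟨φ₀, h1, hpos, heig, ?_, ?_⟩
  · rw [rectTubeFluxProjection_apply_of_invariant z hinv, if_pos rfl]
  · rw [rectTubeFluxProjection_apply_of_invariant z hinv, if_neg he]

/-- `SU(2)`, `z = −1`, rectangular cross-section: the trivial-sector flux energy vanishes for every real `β`.
[folklore] -/
theorem su2_rectTubeFluxEnergy_zero (β : ℝ) (Ls : Fin k → ℕ) [∀ i, NeZero (Ls i)] :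
    rectTubeFluxEnergy (Literature.MathematicalPhysics.QuantumLattice.fundamentalRep (Fin 2)) su2MinusOne (β / 2)
      Ls 0 = 0 := by
  haveI : SecondCountableTopology (Matrix.specialUnitaryGroup (Fin 2) ℂ) :=
    Literature.MathematicalPhysics.QuantumLattice.secondCountableTopology_su2
  exact rectTubeFluxEnergy_zero (Literature.MathematicalPhysics.QuantumLattice.fundamentalRep (Fin 2)) (β / 2)
    (Literature.MathematicalPhysics.QuantumLattice.continuous_fundamentalRep (Fin 2))
    Literature.MathematicalPhysics.QuantumLattice.fundamentalRep_mem_unitaryGroup su2MinusOne_mem_center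

end Vacuum

end Summit.Ventures.YMGap.FlowData
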